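import Mathlib.Algebra.Exact.Basic
import Mathlib.Algebra.Group.Torsion
import HarnessLib

/-!
# Torsion in exact sequences of abelian groups

Carrier-level lemmas about torsion ELEMENTS (`∃ m : ℤ, m ≠ 0 ∧ m • x = 0`) and torsion-FREE
abelian groups (`∀ m : ℤ, m ≠ 0 → ∀ x, m • x = 0 → x = 0`) in exact sequences of additive
groups (`AddCommGroup`, `→+`, Mathlib's `Function.Exact f g : ∀ y, g y = 0 ↔ y ∈ Set.range f`).
Both notions are written INLINE (the forms the consumer quantifies over); they are Mathlib's
`IsOfFinAddOrder x` (`isOfFinAddOrder_iff_zsmul_eq_zero`) and `IsAddTorsionFree M`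
(`isAddTorsionFree_iff_zsmul_eq_zero` below). Everything is proved, no named facts.

* bookkeeping: `torsion_map`, `torsion_add`, `torsion_of_zsmul_torsion`, `zsmul_eq_zero_of_dvd`,
  `torsionFree_of_injective`, `isAddTorsionFree_iff_zsmul_eq_zero`;
* `eq_zero_of_range_torsion_of_torsionFree` (+ elementwise form): an additive map with torsion
  values into a torsion-free group is zero ("`δ ⊗ ℚ = 0` ⇒ `δ = 0`");
* `surjective_of_exact_of_eq_zero` / `injective_of_exact_of_eq_zero`: in `G → E →δ F` (resp.
  `E →δ F → G`) exact, `δ = 0` forces the other map onto (resp. one-to-one); the `…_range_torsion`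
  forms combine this with the previous item (`exists_zsmul_mem_range_of_exact` is the raw step);
* `torsionFree_of_exact`: in `F →i G →π E` exact at `G`, `i` injective, `F`, `E` torsion-free ⇒
  `G` torsion-free; `torsionFree_of_exact_of_exact`: the same with "`i` injective" replaced by
  "`D →δ F →i G` exact, `δ = 0`";
* squares `t ∘ δ₁ = δ₂ ∘ s` with `s` onto: `eq_zero_of_comp_eq_of_surjective` (`δ₁ = 0 ⇒ δ₂ = 0`),
  `range_torsion_of_comp_eq_of_surjective` (torsion values transfer), and the consumer-named
  corollary `connecting_eq_zero_of_surjective_reduction`.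

## Why (where this is used)

For a smooth proper formal scheme `𝒳 / W(k)` the Hodge–de Rham spectral sequence (that of the
stupid filtration of the de Rham complex) degenerates at `E₁` after `⊗ ℚ` (characteristic `0`):
the connecting maps of the long exact sequences of the stupid filtration have torsion values.
When the Hodge groups `H^b(𝒳, Ωʲ)` are torsion-free, the lemmas here upgrade this INTEGRALLY by
induction along the filtration: the connecting maps vanish, `H(F^i) → H(gr^i)` is onto,
`H(F^{i+1}) → H(F^i)` one-to-one, the pieces `H(F^i)` stay torsion-free, and surjective
reduction maps kill the connecting maps at every finite level `𝒳_N` — the group-theoretic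
steps behind X. Hu, *On the `p`-adic deformation of algebraic cycle classes* (arXiv:2507.12458)
§11 and Bloch–Esnault–Kerz, *`p`-adic deformation of algebraic cycle classes* (Invent. Math.
195 (2014); arXiv:1203.2776, Remarks 35 (1)–(2)).

## What is NOT here

No complexes, categories or spectral sequences; no `Submodule.torsion`; no compatible families
(their `ℕ`-indexed analogues `torsionFamily_eq_zero_of_extension`, `surjective_of_four` live in
`Literature.Algebra.Homology.InverseSystemExtensions`). Mathlib searched (pin): `Function.Exact`,
`IsAddTorsionFree`, `IsOfFinAddOrder`, `Module.IsTorsionFree`, `Submodule.torsion` — the notions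
are there, none of the exact-sequence statements below is.
-/

namespace Literature.Algebra.Homology

/-! ### Torsion elements: bookkeeping -/

section Elements

variable {E : Type*} {F : Type*} [AddCommGroup E] [AddCommGroup F]

/-- The image of a torsion element under an additive map is torsion: if `m • x = 0` with
`m ≠ 0` then `m • f x = 0`. [folklore] -/
theorem torsion_map (f : E →+ F) {x : E} (hx : ∃ m : ℤ, m ≠ 0 ∧ m • x = 0) :
    ∃ m : ℤ, m ≠ 0 ∧ m • f x = 0 :=
  let ⟨m, hm, hmx⟩ := hx; ⟨m, hm, by rw [← map_zsmul, hmx, map_zero]⟩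

/-- The sum of two torsion elements is torsion: if `m • x = 0` and `n • y = 0` with
`m, n ≠ 0`, then `(m * n) • (x + y) = 0` and `m * n ≠ 0`. [folklore] -/
theorem torsion_add {x y : E} (hx : ∃ m : ℤ, m ≠ 0 ∧ m • x = 0)
    (hy : ∃ m : ℤ, m ≠ 0 ∧ m • y = 0) : ∃ m : ℤ, m ≠ 0 ∧ m • (x + y) = 0 :=
  let ⟨m, hm, hmx⟩ := hx; let ⟨n, hn, hny⟩ := hy
  ⟨m * n, mul_ne_zero hm hn, by
    rw [zsmul_add, mul_zsmul', hmx, zsmul_zero, mul_zsmul, hny, zsmul_zero, add_zero]⟩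

/-- If a non-zero multiple `n • x` of `x` is torsion, then `x` is torsion
(`m • (n • x) = 0` gives `(m * n) • x = 0` with `m * n ≠ 0`). [folklore] -/
theorem torsion_of_zsmul_torsion {n : ℤ} (hn : n ≠ 0) {x : E}
    (hx : ∃ m : ℤ, m ≠ 0 ∧ m • (n • x) = 0) : ∃ m : ℤ, m ≠ 0 ∧ m • x = 0 :=
  let ⟨m, hm, hmx⟩ := hx; ⟨m * n, mul_ne_zero hm hn, by rw [mul_zsmul, hmx]⟩

/-- Closure of annihilators under multiples: if `m • x = 0` and `m ∣ n` then `n • x = 0`.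
[folklore] -/
theorem zsmul_eq_zero_of_dvd {m n : ℤ} (h : m ∣ n) {x : E} (hx : m • x = 0) : n • x = 0 := by
  obtain ⟨k, rfl⟩ := h
  rw [mul_zsmul', hx, zsmul_zero]

/-- **Bridge to Mathlib.** The inline torsion-freeness hypothesis of this file is Mathlib's
class `IsAddTorsionFree` (injectivity of `x ↦ n • x` for `n : ℕ`, `n ≠ 0`): an additive
commutative group is torsion-free iff `m • x = 0` with `m : ℤ`, `m ≠ 0` forces `x = 0`.
[folklore] -/
theorem isAddTorsionFree_iff_zsmul_eq_zero :
    IsAddTorsionFree E ↔ ∀ m : ℤ, m ≠ 0 → ∀ x : E, m • x = 0 → x = 0 := by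
  refine ⟨fun _ m hm x hx => (IsAddTorsionFree.zsmul_eq_zero_iff_right hm).mp hx,
    fun h => ⟨fun n hn a b hab => sub_eq_zero.mp (h n (Int.natCast_ne_zero.mpr hn) _ ?_)⟩⟩
  rw [zsmul_sub, natCast_zsmul, natCast_zsmul, sub_eq_zero]
  exact hab

/-- In a torsion-free abelian group every torsion element is zero. [folklore] -/
theorem eq_zero_of_torsion_of_torsionFree
    (hF : ∀ m : ℤ, m ≠ 0 → ∀ y : F, m • y = 0 → y = 0) {y : F}
    (hy : ∃ m : ℤ, m ≠ 0 ∧ m • y = 0) : y = 0 :=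
  let ⟨m, hm, hmy⟩ := hy; hF m hm y hmy

/-- **Rationally zero into torsion-free is zero (elementwise).** If every value of
`δ : E →+ F` is torsion and `F` is torsion-free, then `δ x = 0` for every `x`. [folklore] -/
theorem apply_eq_zero_of_range_torsion_of_torsionFree (δ : E →+ F)
    (hδ : ∀ x : E, ∃ m : ℤ, m ≠ 0 ∧ m • δ x = 0)
    (hF : ∀ m : ℤ, m ≠ 0 → ∀ y : F, m • y = 0 → y = 0) (x : E) : δ x = 0 :=
  eq_zero_of_torsion_of_torsionFree hF (hδ x)

/-- **Rationally zero into torsion-free is zero.** If every value of `δ : E →+ F` is torsion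
(i.e. `δ ⊗ ℚ = 0`) and `F` is torsion-free, then `δ = 0`. [folklore] -/
theorem eq_zero_of_range_torsion_of_torsionFree (δ : E →+ F)
    (hδ : ∀ x : E, ∃ m : ℤ, m ≠ 0 ∧ m • δ x = 0)
    (hF : ∀ m : ℤ, m ≠ 0 → ∀ y : F, m • y = 0 → y = 0) : δ = 0 :=
  AddMonoidHom.ext fun x => apply_eq_zero_of_range_torsion_of_torsionFree δ hδ hF x

/-- A subgroup of a torsion-free group is torsion-free: if `f : E →+ F` is injective and `F`
is torsion-free then so is `E`. (The trivial half of "in `0 → A → B → C → 0`, `B` torsion-free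
⇒ `A` torsion-free".) [folklore] -/
theorem torsionFree_of_injective (f : E →+ F) (hf : Function.Injective f)
    (hF : ∀ m : ℤ, m ≠ 0 → ∀ y : F, m • y = 0 → y = 0) :
    ∀ m : ℤ, m ≠ 0 → ∀ x : E, m • x = 0 → x = 0 := fun m hm x hx =>
  hf ((hF m hm (f x) (by rw [← map_zsmul, hx, map_zero])).trans (map_zero f).symm)

end Elements

/-! ### Three-term exact sequences -/

section Exact

variable {D : Type*} {E : Type*} {F : Type*} {G : Type*}
  [AddCommGroup D] [AddCommGroup E] [AddCommGroup F] [AddCommGroup G]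

/-- In `G →π E →δ F` exact at `E`, if `δ` vanishes identically then `π` is surjective
(`ker δ = E` is the range of `π`). [folklore] -/
theorem surjective_of_exact_of_apply_eq_zero {π : G →+ E} {δ : E →+ F}
    (h : Function.Exact π δ) (hδ : ∀ x : E, δ x = 0) : Function.Surjective π :=
  fun x => (h x).mp (hδ x)

/-- In `G →π E →δ F` exact at `E`, `δ = 0` implies that `π` is surjective. [folklore] -/
theorem surjective_of_exact_of_eq_zero {π : G →+ E} {δ : E →+ F}
    (h : Function.Exact π δ) (hδ : δ = 0) : Function.Surjective π :=
  surjective_of_exact_of_apply_eq_zero h fun x => by rw [hδ, AddMonoidHom.zero_apply]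

/-- In `E →δ F →i G` exact at `F`, if `δ` vanishes identically then `i` is injective
(`ker i = im δ = 0`). [folklore] -/
theorem injective_of_exact_of_apply_eq_zero {δ : E →+ F} {i : F →+ G}
    (h : Function.Exact δ i) (hδ : ∀ x : E, δ x = 0) : Function.Injective i :=
  (injective_iff_map_eq_zero i).mpr fun y hy => by
    obtain ⟨x, rfl⟩ := (h y).mp hy
    exact hδ x

/-- In `E →δ F →i G` exact at `F`, `δ = 0` implies that `i` is injective. [folklore] -/
theorem injective_of_exact_of_eq_zero {δ : E →+ F} {i : F →+ G}
    (h : Function.Exact δ i) (hδ : δ = 0) : Function.Injective i :=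
  injective_of_exact_of_apply_eq_zero h fun x => by rw [hδ, AddMonoidHom.zero_apply]

/-- **Rational lifting.** In `G →π E →δ F` exact at `E`, if `δ x` is torsion then some
non-zero multiple `m • x` lies in the range of `π`. [folklore] -/
theorem exists_zsmul_mem_range_of_exact {π : G →+ E} {δ : E →+ F}
    (h : Function.Exact π δ) {x : E} (hx : ∃ m : ℤ, m ≠ 0 ∧ m • δ x = 0) :
    ∃ m : ℤ, m ≠ 0 ∧ ∃ y : G, π y = m • x :=
  let ⟨m, hm, hmx⟩ := hx; ⟨m, hm, (h (m • x)).mp (by rw [map_zsmul, hmx])⟩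

/-- **Rational degeneration ⇒ integral surjectivity.** In `G →π E →δ F` exact at `E`, if
every value of `δ` is torsion and `F` is torsion-free, then `π` is surjective. [folklore] -/
theorem surjective_of_exact_of_range_torsion {π : G →+ E} {δ : E →+ F}
    (h : Function.Exact π δ) (hδ : ∀ x : E, ∃ m : ℤ, m ≠ 0 ∧ m • δ x = 0)
    (hF : ∀ m : ℤ, m ≠ 0 → ∀ y : F, m • y = 0 → y = 0) : Function.Surjective π :=
  surjective_of_exact_of_apply_eq_zero h
    (apply_eq_zero_of_range_torsion_of_torsionFree δ hδ hF)

/-- **Rational degeneration ⇒ integral injectivity.** In `E →δ F →i G` exact at `F`, if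
every value of `δ` is torsion and `F` is torsion-free, then `i` is injective. [folklore] -/
theorem injective_of_exact_of_range_torsion {δ : E →+ F} {i : F →+ G}
    (h : Function.Exact δ i) (hδ : ∀ x : E, ∃ m : ℤ, m ≠ 0 ∧ m • δ x = 0)
    (hF : ∀ m : ℤ, m ≠ 0 → ∀ y : F, m • y = 0 → y = 0) : Function.Injective i :=
  injective_of_exact_of_apply_eq_zero h
    (apply_eq_zero_of_range_torsion_of_torsionFree δ hδ hF)

/-- **Torsion-freeness in extensions.** In `F →i G →π E` exact at `G` with `i` injective,
if `F` and `E` are torsion-free then so is `G` (chase: `m • x = 0` gives `m • π x = 0`, so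
`π x = 0` and `x = i y`; then `i (m • y) = 0`, so `m • y = 0` and `y = 0`). In particular the
middle term of a short exact sequence with torsion-free ends is torsion-free (the
surjectivity of `π` is not used). [folklore] -/
theorem torsionFree_of_exact {i : F →+ G} {π : G →+ E} (h : Function.Exact i π)
    (hi : Function.Injective i) (hF : ∀ m : ℤ, m ≠ 0 → ∀ y : F, m • y = 0 → y = 0)
    (hE : ∀ m : ℤ, m ≠ 0 → ∀ z : E, m • z = 0 → z = 0) :
    ∀ m : ℤ, m ≠ 0 → ∀ x : G, m • x = 0 → x = 0 := by
  intro m hm x hx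
  obtain ⟨y, rfl⟩ := (h x).mp (hE m hm (π x) (by rw [← map_zsmul, hx, map_zero]))
  rw [hF m hm y (hi (by rw [map_zsmul, hx, map_zero])), map_zero]

/-- **Torsion-freeness in extensions, four-term form.** In `D →δ F →i G →π E` exact at `F`
and at `G`, if `δ = 0` (so that `i` is injective) and `F`, `E` are torsion-free, then `G` is
torsion-free (the induction step keeping the filtered pieces `H(F^i)` of a rationally
degenerate filtered complex with torsion-free graded cohomology torsion-free). [folklore] -/
theorem torsionFree_of_exact_of_exact {δ : D →+ F} {i : F →+ G} {π : G →+ E}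
    (hδi : Function.Exact δ i) (hiπ : Function.Exact i π) (hδ : ∀ w : D, δ w = 0)
    (hF : ∀ m : ℤ, m ≠ 0 → ∀ y : F, m • y = 0 → y = 0)
    (hE : ∀ m : ℤ, m ≠ 0 → ∀ z : E, m • z = 0 → z = 0) :
    ∀ m : ℤ, m ≠ 0 → ∀ x : G, m • x = 0 → x = 0 :=
  torsionFree_of_exact hiπ (injective_of_exact_of_apply_eq_zero hδi hδ) hF hE

end Exact

/-! ### Commuting squares: transferring vanishing along a surjection -/

section Square

variable {E₁ : Type*} {E₂ : Type*} {F₁ : Type*} {F₂ : Type*}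
  [AddCommGroup E₁] [AddCommGroup E₂] [AddCommGroup F₁] [AddCommGroup F₂]

/-- **Zero transfers along squares with a surjective side.** Given a commuting square of
additive maps `t ∘ δ₁ = δ₂ ∘ s` (rows `δ₁ : E₁ →+ F₁`, `δ₂ : E₂ →+ F₂`, vertical maps
`s : E₁ →+ E₂`, `t : F₁ →+ F₂`) with `s` surjective, if `δ₁ = 0` then `δ₂ = 0`
(`δ₂ (s x) = t (δ₁ x) = 0` and every element of `E₂` is an `s x`). [folklore] -/
theorem eq_zero_of_comp_eq_of_surjective {s : E₁ →+ E₂} {t : F₁ →+ F₂} {δ₁ : E₁ →+ F₁}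
    {δ₂ : E₂ →+ F₂} (hsq : t.comp δ₁ = δ₂.comp s) (hs : Function.Surjective s)
    (h₁ : δ₁ = 0) : δ₂ = 0 := by
  ext y
  obtain ⟨x, rfl⟩ := hs y
  simpa [h₁] using (DFunLike.congr_fun hsq x).symm

/-- **Rational vanishing transfers along squares with a surjective side.** Given a commuting
square `t ∘ δ₁ = δ₂ ∘ s` of additive maps with `s` surjective, if every value of `δ₁` is
torsion then every value of `δ₂` is torsion (`δ₂ (s x) = t (δ₁ x)` and `t` preserves
torsion). [folklore] -/
theorem range_torsion_of_comp_eq_of_surjective {s : E₁ →+ E₂} {t : F₁ →+ F₂} {δ₁ : E₁ →+ F₁}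
    {δ₂ : E₂ →+ F₂} (hsq : t.comp δ₁ = δ₂.comp s) (hs : Function.Surjective s)
    (h₁ : ∀ x : E₁, ∃ m : ℤ, m ≠ 0 ∧ m • δ₁ x = 0) (y : E₂) :
    ∃ m : ℤ, m ≠ 0 ∧ m • δ₂ y = 0 := by
  obtain ⟨x, rfl⟩ := hs y
  rw [← AddMonoidHom.comp_apply, ← hsq]
  exact torsion_map t (h₁ x)

/-- **Base-change surjection kills the finite-level connecting maps.** Let `sH : HX →+ HN` be
the reduction map on the cohomology of one term (e.g. `H^b(𝒳, Ωʲ) → H^b(𝒳_N, Ωʲ)`),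
`tH : KX →+ KN` the one on the next hypercohomology group, and `δX`, `δN` the connecting maps
over `𝒳` and over `𝒳_N`, with `δN ∘ sH = tH ∘ δX`. If `sH` is surjective and `δX = 0`, then
`δN = 0` (`eq_zero_of_comp_eq_of_surjective` with the roles named). [folklore] -/
theorem connecting_eq_zero_of_surjective_reduction {HX : Type*} {HN : Type*} {KX : Type*}
    {KN : Type*} [AddCommGroup HX] [AddCommGroup HN] [AddCommGroup KX] [AddCommGroup KN]
    {sH : HX →+ HN} {tH : KX →+ KN} {δX : HX →+ KX} {δN : HN →+ KN}
    (hsq : δN.comp sH = tH.comp δX) (hs : Function.Surjective sH) (hX : δX = 0) : δN = 0 :=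
  eq_zero_of_comp_eq_of_surjective hsq.symm hs hX

end Square

end Literature.Algebra.Homology
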